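import Literature.MathematicalPhysics.QuantumFieldTheory.Balaban1983to89.Beta.HessKerSchur

/-!
# `Balaban1983to89.Beta.HessKerSchurL2` — the WEIGHTED-`ℓ²` (Combes–Thomas-native) column / row classes and their Cauchy–Schwarz
# bridge into the weighted Schur classes `ColW` / `RowW` of `Beta.HessKerSchur` (road A2 / (SW1) of the β sub-cell, CONSTANTS half;
# asymptotic lane asym1, gen 8, item 3, v1; v1.1 = docstring-only: two illustration figures below rounded correctly,
# declarations byte-identical)

HONEST FRAMING (cell contract, verbatim): «discharging `BetaPertH` makes Bałaban's UV stability UNCONDITIONAL — a real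
constructive-QFT result; it is NOT the continuum limit and NOT the Clay problem.»  THIS MODULE is [folklore] analysis on `ℤ^D`
(Cauchy–Schwarz over a finite index set, the lattice Gaussian sum `Zl`); it formalises NO statement printed in Bałaban's papers, cites
none as a hypothesis, mints no `Prop` fact, instantiates NO binder of the wall (RULING (R18-3)) and DISCHARGES NOTHING of it.  NOT summit
progress.

ABSOLUTE RULE (cell, verbatim): «No internally-minted statement may enter as a cited fact. Every hypothesis is either
kernel-proved in this package or a verbatim quotation of a PUBLISHED theorem with page reference. The manuscript(s) under
audit are NOT citable for their own disputed steps — they are the thing under adjudication; programme-internal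
(2001/route/tribunal) claims are never citable.»  Every theorem below is kernel-proved from explicit, abstract hypotheses on
matrix-fibred kernels; nothing asserts that any kernel IS Bałaban's.

WHY THIS LEAF (budget bookkeeping, O-asym1-6).  `HessKerSchur` takes the resolvent primitive `K` in the weighted COLUMN class
`ColW K R B` (`Σ_{x} Σ_a |K x y a b|·e^{R|x−y|₁} ≤ B` per column) and delivers the (5.10)-decay / Lipschitz / `GeomRate` chain of
`hessKer` at decay length `R·N`.  A Combes–Thomas bound done in the sup/sum norms (the style of the weighted norms printed in
[Balaban1984PropagatorsII] Lemma 2.1 (2.61)–(2.63), p. 234 — norm attribution only, nothing printed there is a hypothesis here) IS a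
`ColW` datum.  The tree's Combes–Thomas machinery, however, is in QUADRATIC-FORM / weighted-`ℓ²` shape (`Beta.CombesThomasFormOp`:
`Σ_j (e^{φ_j} v_j)² ≤ (2/σ)² Σ_j (e^{φ_j} g_j)²`; `Beta.DeltaACombesThomas*`), whose natural per-column output is a weighted `ℓ²` bound
`Σ_x Σ_a (K x y a b)²·e^{2κ|x−y|₁} ≤ B²`.  Two ways lead from there into `ColW` at a rate `R < κ`:
* via the POINTWISE class: `(K x y a b)² e^{2κ|x−y|₁} ≤ B²` ⟹ `|K x y a b| ≤ B e^{−κ|x−y|₁}` (free), then `HessKerSchur.colW_of_decays`: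
  `ColW K R (|F|·B·Zl_D(κ−R))`;
* via CAUCHY–SCHWARZ over `(x, a)` (this leaf, `colW_of_colL2`): `ColW K R (√(|F|·Zl_D(2(κ−R)))·B)`.
Since `Zl_D(s) = coth(s/2)^D`, the second constant is the SQUARE ROOT of a lattice Gaussian sum at twice the gap: e.g. `D = 5`,
`κ − R = 1/2`, `|F| = |Fib 4| = 10`: `|F|·Zl₅(1/2) ≈ 1.13·10⁴` against `√(10·Zl₅(1)) ≈ 21.8` (generating-function arithmetic,
illustration only; `coth(1/4)⁵ ≈ 1135`, `coth(1/2)⁵ ≈ 47.5` (v1.1: rounded from 1134.72 and 47.450; v1 printed 1134 and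
47.4); the actual `κ, R` are supplier data).  Every resolvent constant of
`HessKerSchur.lipW` picks the conversion factor up, and its bubble terms carry three uniform resolvent/vertex factors times one
deviation, so the factor enters road A2's `c₀` up to the FOURTH power (`(1.13·10⁴)⁴ ≈ 1.7·10¹⁶` against `21.8⁴ ≈ 2.3·10⁵` in the
example) — i.e. it co-decides how deep the certified finite range `k₁` must be.  This leaf
records the cheap inequality once, in the classes `HessKerSchur` consumes, together with the rate-family corollaries and the
END corollary `geomRate_secondMoment_hessKer_primitivesW_of_colL2` (weighted-`ℓ²` resolvent data in, `GeomRate` at rate `R·N` out).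

CONTENT.  §1 `ColL2 K κ B` / `RowL2 K κ B` (`0 ≤ B` recorded, finite-partial-sum form, as in `HessKerSchur`), monotonicity, the free
pointwise consequence `ColL2.decays : Decays K B κ`.  §2 `colW_of_colL2`, `rowW_of_rowL2` (Cauchy–Schwarz, constant
`√(|F|·Zl_D(2(κ−R)))·B`, any `R < κ`).  §3 rate-family corollaries (uniform data and geometric deviations keep their shape:
`√(…)·c·θ^j`).  §4 the END corollary through `HessKerSchur.geomRate_secondMoment_hessKer_primitivesW`.

RELATION TO THE TREE (no duplication): `CombesThomasFormOp` / `CombesThomasKernel` / `DeltaACombesThomas(Sets)` PROVE weighted-`ℓ²`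
and set-to-set bounds for specific finite-volume operators (their dictionary to `MKer`-kernels on `ℤ^D` in block units is the
suppliers' (RULING (R25-1)) business and is NOT done here); `HessKerSchur` = weighted `ℓ¹`; this leaf is only the bridge between the
two kinds of weight.  The sentence of `HessKerSchur`'s header «Resolvent suppliers that come with Combes–Thomas operator bounds land
in `ColW` NATIVELY» refers to sup/sum-norm (ℓ¹→ℓ¹ / ℓ^∞→ℓ^∞) operator bounds; for `ℓ²`-form bounds the entry is THIS leaf, at the
cost `√(|F|·Zl_D(2(κ−R)))`.

WHAT IS NOT HERE (located, NOT in print, NOT claimed): any `ColL2` datum for Bałaban's (rescaled) resolvent kernels — the `j`-uniform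
one is an (α)-type input, the geometric deviation one is (CONV-C) (AN2.md §6; OPEN, O-an2-2 / O-asym1-1, not in print); any numeric
value of `κ, B` for Bałaban's kernels.  NOT continuum, NOT Clay.
-/

open Finset Filter
open scoped BigOperators
open Literature.MathematicalPhysics.QuantumFieldTheory.Balaban1983to89
open Literature.MathematicalPhysics.QuantumFieldTheory.Balaban1983to89.Beta
open B12Sec2to5 (l1 l1_nonneg Decay510 betaPrime510)
open ExpKernelCalculus (MKer Decays VertexFamily₂ hessKer Zl Zl_nonneg summable_exp_shift summable_exp_shift' tsum_exp_shift
  tsum_exp_shift')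
open HessKerSchur (RowW ColW BiW VertexFamilyW VertexFamily₂W lipW LocStencilW geomRate_secondMoment_hessKer_primitivesW
  oneLoopDrift_secondMoment_hessKer_primitivesW)
open OneStepResolventKernel (Fib)
open OneStepKernelFamily (vertexOfK)

namespace Literature.MathematicalPhysics.QuantumFieldTheory.Balaban1983to89.Beta.HessKerSchurL2

noncomputable section

variable {D : ℕ} {F : Type*} [Fintype F]

/-! ## §1 Weighted-`ℓ²` column and row classes -/

/-- WEIGHTED-`ℓ²` COLUMN BOUND (the Combes–Thomas-native shape): `0 ≤ B` and
`Σ_{x∈s} Σ_a (K x y a b)²·e^{2κ|x−y|₁} ≤ B²` for every column `(y, b)` and every finite `s`. [folklore] -/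
def ColL2 (K : MKer D F) (κ B : ℝ) : Prop :=
  0 ≤ B ∧ ∀ (y : Fin D → ℤ) (b : F) (s : Finset (Fin D → ℤ)),
    ∑ x ∈ s, ∑ a, K x y a b ^ 2 * Real.exp (2 * κ * l1 (x - y)) ≤ B ^ 2

/-- WEIGHTED-`ℓ²` ROW BOUND: `0 ≤ B` and `Σ_{y∈s} Σ_b (K x y a b)²·e^{2κ|x−y|₁} ≤ B²` for every row `(x, a)` and every finite `s`.
[folklore] -/
def RowL2 (K : MKer D F) (κ B : ℝ) : Prop :=
  0 ≤ B ∧ ∀ (x : Fin D → ℤ) (a : F) (s : Finset (Fin D → ℤ)),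
    ∑ y ∈ s, ∑ b, K x y a b ^ 2 * Real.exp (2 * κ * l1 (x - y)) ≤ B ^ 2

/-- The bound of a `ColL2` class is nonnegative. [folklore] -/
theorem ColL2.nonneg {K : MKer D F} {κ B : ℝ} (h : ColL2 K κ B) : 0 ≤ B := h.1

/-- The bound of a `RowL2` class is nonnegative. [folklore] -/
theorem RowL2.nonneg {K : MKer D F} {κ B : ℝ} (h : RowL2 K κ B) : 0 ≤ B := h.1

/-- `ColL2` is monotone in the bound. [folklore] -/
theorem ColL2.mono {K : MKer D F} {κ B B' : ℝ} (h : ColL2 K κ B) (hB : B ≤ B') : ColL2 K κ B' :=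
  ⟨h.1.trans hB, fun y b s => (h.2 y b s).trans (pow_le_pow_left₀ h.1 hB 2)⟩

/-- `RowL2` is monotone in the bound. [folklore] -/
theorem RowL2.mono {K : MKer D F} {κ B B' : ℝ} (h : RowL2 K κ B) (hB : B ≤ B') : RowL2 K κ B' :=
  ⟨h.1.trans hB, fun x a s => (h.2 x a s).trans (pow_le_pow_left₀ h.1 hB 2)⟩

/-- `ColL2` is monotone (downwards) in the rate. [folklore] -/
theorem ColL2.of_le {K : MKer D F} {κ κ' B : ℝ} (h : ColL2 K κ B) (hκ : κ' ≤ κ) : ColL2 K κ' B := by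
  refine ⟨h.1, fun y b s => le_trans (Finset.sum_le_sum fun x _ => Finset.sum_le_sum fun a _ => ?_) (h.2 y b s)⟩
  exact mul_le_mul_of_nonneg_left (Real.exp_le_exp.2 (by have := l1_nonneg (x - y); nlinarith)) (sq_nonneg _)

/-- `RowL2` is monotone (downwards) in the rate. [folklore] -/
theorem RowL2.of_le {K : MKer D F} {κ κ' B : ℝ} (h : RowL2 K κ B) (hκ : κ' ≤ κ) : RowL2 K κ' B := by
  refine ⟨h.1, fun x a s => le_trans (Finset.sum_le_sum fun y _ => Finset.sum_le_sum fun b _ => ?_) (h.2 x a s)⟩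
  exact mul_le_mul_of_nonneg_left (Real.exp_le_exp.2 (by have := l1_nonneg (x - y); nlinarith)) (sq_nonneg _)

/-- The zero kernel is in every `ColL2` class with bound `0` (the limit member of a deviation family). [folklore] -/
theorem colL2_zero (κ : ℝ) : ColL2 (0 : MKer D F) κ 0 :=
  ⟨le_rfl, fun y b s => by simp⟩

/-- The zero kernel is in every `RowL2` class with bound `0`. [folklore] -/
theorem rowL2_zero (κ : ℝ) : RowL2 (0 : MKer D F) κ 0 :=
  ⟨le_rfl, fun x a s => by simp⟩

/-- One weighted square is below the column budget. [folklore] -/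
theorem ColL2.sq_le {K : MKer D F} {κ B : ℝ} (h : ColL2 K κ B) (x y : Fin D → ℤ) (a b : F) :
    K x y a b ^ 2 * Real.exp (2 * κ * l1 (x - y)) ≤ B ^ 2 := by
  classical
  have hs := h.2 y b {x}
  rw [Finset.sum_singleton] at hs
  exact (Finset.single_le_sum (f := fun a' => K x y a' b ^ 2 * Real.exp (2 * κ * l1 (x - y)))
    (fun a' _ => by positivity) (Finset.mem_univ a)).trans hs

/-- One weighted square is below the row budget. [folklore] -/
theorem RowL2.sq_le {K : MKer D F} {κ B : ℝ} (h : RowL2 K κ B) (x y : Fin D → ℤ) (a b : F) :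
    K x y a b ^ 2 * Real.exp (2 * κ * l1 (x - y)) ≤ B ^ 2 := by
  classical
  have hs := h.2 x a {y}
  rw [Finset.sum_singleton] at hs
  exact (Finset.single_le_sum (f := fun b' => K x y a b' ^ 2 * Real.exp (2 * κ * l1 (x - y)))
    (fun b' _ => by positivity) (Finset.mem_univ b)).trans hs

/-- The elementary step `t²·e^{2κℓ} ≤ B²`, `0 ≤ B` ⟹ `|t| ≤ B·e^{−κℓ}`. [folklore] -/
theorem abs_le_of_sq_weight_le {t ℓ κ B : ℝ} (h : t ^ 2 * Real.exp (2 * κ * ℓ) ≤ B ^ 2) (hB : 0 ≤ B) :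
    |t| ≤ B * Real.exp (-κ * ℓ) := by
  have h2 : (|t| * Real.exp (κ * ℓ)) ^ 2 ≤ B ^ 2 := by
    calc (|t| * Real.exp (κ * ℓ)) ^ 2 = t ^ 2 * Real.exp (2 * κ * ℓ) := by
          rw [mul_pow, sq_abs, ← Real.exp_nat_mul]; push_cast; ring_nf
      _ ≤ B ^ 2 := h
  have h3 : |t| * Real.exp (κ * ℓ) ≤ B := (abs_le_of_sq_le_sq' h2 hB).2
  calc |t| = |t| * Real.exp (κ * ℓ) * Real.exp (-κ * ℓ) := by
        rw [mul_assoc, ← Real.exp_add]; simp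
    _ ≤ B * Real.exp (-κ * ℓ) := mul_le_mul_of_nonneg_right h3 (Real.exp_pos _).le

/-- **WEIGHTED `ℓ²` ⟹ POINTWISE** (free): `ColL2 K κ B` ⟹ `Decays K B κ`. [folklore] -/
theorem ColL2.decays {K : MKer D F} {κ B : ℝ} (h : ColL2 K κ B) : Decays K B κ :=
  fun x y a b => abs_le_of_sq_weight_le (h.sq_le x y a b) h.1

/-- **WEIGHTED `ℓ²` ⟹ POINTWISE** (rows): `RowL2 K κ B` ⟹ `Decays K B κ`. [folklore] -/
theorem RowL2.decays {K : MKer D F} {κ B : ℝ} (h : RowL2 K κ B) : Decays K B κ :=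
  fun x y a b => abs_le_of_sq_weight_le (h.sq_le x y a b) h.1

/-! ## §2 The Cauchy–Schwarz bridge into the weighted Schur classes -/

/-- The lattice factor of the bridge: `Σ_{x∈s} Σ_{a:F} e^{−2(κ−R)|x−y|₁} ≤ |F|·Zl_D(2(κ−R))`. [folklore] -/
theorem sum_sq_weight_le {κ R : ℝ} (hR : R < κ) (y : Fin D → ℤ) (s : Finset (Fin D → ℤ)) :
    ∑ x ∈ s, ∑ _a : F, Real.exp (-(κ - R) * l1 (x - y)) ^ 2 ≤ (Fintype.card F : ℝ) * Zl D (2 * (κ - R)) := by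
  have hκR : 0 < 2 * (κ - R) := by linarith
  have hs' := summable_exp_shift' (D := D) hκR y
  have hsq : ∀ x : Fin D → ℤ, Real.exp (-(κ - R) * l1 (x - y)) ^ 2 = Real.exp (-(2 * (κ - R)) * l1 (x - y)) := fun x => by
    rw [← Real.exp_nat_mul]; push_cast; ring_nf
  calc ∑ x ∈ s, ∑ _a : F, Real.exp (-(κ - R) * l1 (x - y)) ^ 2
      = ∑ x ∈ s, (Fintype.card F : ℝ) * Real.exp (-(2 * (κ - R)) * l1 (x - y)) := by
        refine Finset.sum_congr rfl fun x _ => ?_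
        rw [Finset.sum_const, Finset.card_univ, nsmul_eq_mul, hsq]
    _ = (Fintype.card F : ℝ) * ∑ x ∈ s, Real.exp (-(2 * (κ - R)) * l1 (x - y)) := by rw [Finset.mul_sum]
    _ ≤ (Fintype.card F : ℝ) * ∑' x : Fin D → ℤ, Real.exp (-(2 * (κ - R)) * l1 (x - y)) :=
        mul_le_mul_of_nonneg_left (hs'.sum_le_tsum s (fun x _ => (Real.exp_pos _).le)) (by positivity)
    _ = (Fintype.card F : ℝ) * Zl D (2 * (κ - R)) := by rw [tsum_exp_shift']

/-- Row version of the lattice factor: `Σ_{y∈s} Σ_{b:F} e^{−2(κ−R)|x−y|₁} ≤ |F|·Zl_D(2(κ−R))`. [folklore] -/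
theorem sum_sq_weight_le' {κ R : ℝ} (hR : R < κ) (x : Fin D → ℤ) (s : Finset (Fin D → ℤ)) :
    ∑ y ∈ s, ∑ _b : F, Real.exp (-(κ - R) * l1 (x - y)) ^ 2 ≤ (Fintype.card F : ℝ) * Zl D (2 * (κ - R)) := by
  have hκR : 0 < 2 * (κ - R) := by linarith
  have hs' := summable_exp_shift (D := D) hκR x
  have hsq : ∀ y : Fin D → ℤ, Real.exp (-(κ - R) * l1 (x - y)) ^ 2 = Real.exp (-(2 * (κ - R)) * l1 (x - y)) := fun y => by
    rw [← Real.exp_nat_mul]; push_cast; ring_nf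
  calc ∑ y ∈ s, ∑ _b : F, Real.exp (-(κ - R) * l1 (x - y)) ^ 2
      = ∑ y ∈ s, (Fintype.card F : ℝ) * Real.exp (-(2 * (κ - R)) * l1 (x - y)) := by
        refine Finset.sum_congr rfl fun y _ => ?_
        rw [Finset.sum_const, Finset.card_univ, nsmul_eq_mul, hsq]
    _ = (Fintype.card F : ℝ) * ∑ y ∈ s, Real.exp (-(2 * (κ - R)) * l1 (x - y)) := by rw [Finset.mul_sum]
    _ ≤ (Fintype.card F : ℝ) * ∑' y : Fin D → ℤ, Real.exp (-(2 * (κ - R)) * l1 (x - y)) :=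
        mul_le_mul_of_nonneg_left (hs'.sum_le_tsum s (fun y _ => (Real.exp_pos _).le)) (by positivity)
    _ = (Fintype.card F : ℝ) * Zl D (2 * (κ - R)) := by rw [tsum_exp_shift]

/-- The abstract Cauchy–Schwarz step on a finite index set: `Σ f·g ≤ √Z·B` when `Σ f² ≤ B²`, `Σ g² ≤ Z`, `0 ≤ B`, `0 ≤ Z`.
[folklore] -/
theorem sum_mul_le_sqrt_mul {ι : Type*} (T : Finset ι) (f g : ι → ℝ) {B Z : ℝ} (hB : 0 ≤ B) (hZ : 0 ≤ Z)
    (hf : ∑ i ∈ T, f i ^ 2 ≤ B ^ 2) (hg : ∑ i ∈ T, g i ^ 2 ≤ Z) :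
    ∑ i ∈ T, f i * g i ≤ Real.sqrt Z * B := by
  have hsq : (∑ i ∈ T, f i * g i) ^ 2 ≤ (Real.sqrt Z * B) ^ 2 := by
    calc (∑ i ∈ T, f i * g i) ^ 2 ≤ (∑ i ∈ T, f i ^ 2) * ∑ i ∈ T, g i ^ 2 := Finset.sum_mul_sq_le_sq_mul_sq T f g
      _ ≤ B ^ 2 * Z := mul_le_mul hf hg (Finset.sum_nonneg fun i _ => sq_nonneg _) (sq_nonneg _)
      _ = (Real.sqrt Z * B) ^ 2 := by rw [mul_pow, Real.sq_sqrt hZ]; ring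
  exact (abs_le_of_sq_le_sq' hsq (by positivity)).2

/-- **WEIGHTED `ℓ²` ⟹ WEIGHTED SCHUR (columns)**: `ColL2 K κ B`, `R < κ` ⟹ `ColW K R (√(|F|·Zl_D(2(κ−R)))·B)` — Cauchy–Schwarz over
`(x, a)`, the lattice Gaussian sum entering under a SQUARE ROOT at twice the gap. [folklore] -/
theorem colW_of_colL2 {K : MKer D F} {κ B R : ℝ} (h : ColL2 K κ B) (hR : R < κ) :
    ColW K R (Real.sqrt ((Fintype.card F : ℝ) * Zl D (2 * (κ - R))) * B) := by
  classical
  obtain ⟨hB, h⟩ := h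
  have hκR : 0 < 2 * (κ - R) := by linarith
  have hZ : 0 ≤ (Fintype.card F : ℝ) * Zl D (2 * (κ - R)) := by
    have := Zl_nonneg (D := D) hκR; positivity
  refine ⟨by positivity, fun y b s => ?_⟩
  let f : (Fin D → ℤ) × F → ℝ := fun p => |K p.1 y p.2 b| * Real.exp (κ * l1 (p.1 - y))
  let g : (Fin D → ℤ) × F → ℝ := fun p => Real.exp (-(κ - R) * l1 (p.1 - y))
  have hsum : ∑ x ∈ s, ∑ a, |K x y a b| * Real.exp (R * l1 (x - y)) = ∑ p ∈ s ×ˢ (univ : Finset F), f p * g p := by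
    rw [Finset.sum_product]
    refine Finset.sum_congr rfl fun x _ => Finset.sum_congr rfl fun a _ => ?_
    show _ = |K x y a b| * Real.exp (κ * l1 (x - y)) * Real.exp (-(κ - R) * l1 (x - y))
    rw [mul_assoc, ← Real.exp_add]; ring_nf
  have hf2 : ∑ p ∈ s ×ˢ (univ : Finset F), f p ^ 2 ≤ B ^ 2 := by
    rw [Finset.sum_product]
    calc ∑ x ∈ s, ∑ a, f (x, a) ^ 2 = ∑ x ∈ s, ∑ a, K x y a b ^ 2 * Real.exp (2 * κ * l1 (x - y)) := by
          refine Finset.sum_congr rfl fun x _ => Finset.sum_congr rfl fun a _ => ?_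
          show (|K x y a b| * Real.exp (κ * l1 (x - y))) ^ 2 = _
          rw [mul_pow, sq_abs, ← Real.exp_nat_mul]; push_cast; ring_nf
      _ ≤ B ^ 2 := h y b s
  have hg2 : ∑ p ∈ s ×ˢ (univ : Finset F), g p ^ 2 ≤ (Fintype.card F : ℝ) * Zl D (2 * (κ - R)) := by
    rw [Finset.sum_product]
    exact sum_sq_weight_le hR y s
  rw [hsum]
  exact sum_mul_le_sqrt_mul _ f g hB hZ hf2 hg2

/-- **WEIGHTED `ℓ²` ⟹ WEIGHTED SCHUR (rows)**: `RowL2 K κ B`, `R < κ` ⟹ `RowW K R (√(|F|·Zl_D(2(κ−R)))·B)`. [folklore] -/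
theorem rowW_of_rowL2 {K : MKer D F} {κ B R : ℝ} (h : RowL2 K κ B) (hR : R < κ) :
    RowW K R (Real.sqrt ((Fintype.card F : ℝ) * Zl D (2 * (κ - R))) * B) := by
  classical
  obtain ⟨hB, h⟩ := h
  have hκR : 0 < 2 * (κ - R) := by linarith
  have hZ : 0 ≤ (Fintype.card F : ℝ) * Zl D (2 * (κ - R)) := by
    have := Zl_nonneg (D := D) hκR; positivity
  refine ⟨by positivity, fun x a s => ?_⟩
  let f : (Fin D → ℤ) × F → ℝ := fun p => |K x p.1 a p.2| * Real.exp (κ * l1 (x - p.1))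
  let g : (Fin D → ℤ) × F → ℝ := fun p => Real.exp (-(κ - R) * l1 (x - p.1))
  have hsum : ∑ y ∈ s, ∑ b, |K x y a b| * Real.exp (R * l1 (x - y)) = ∑ p ∈ s ×ˢ (univ : Finset F), f p * g p := by
    rw [Finset.sum_product]
    refine Finset.sum_congr rfl fun y _ => Finset.sum_congr rfl fun b _ => ?_
    show _ = |K x y a b| * Real.exp (κ * l1 (x - y)) * Real.exp (-(κ - R) * l1 (x - y))
    rw [mul_assoc, ← Real.exp_add]; ring_nf
  have hf2 : ∑ p ∈ s ×ˢ (univ : Finset F), f p ^ 2 ≤ B ^ 2 := by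
    rw [Finset.sum_product]
    calc ∑ y ∈ s, ∑ b, f (y, b) ^ 2 = ∑ y ∈ s, ∑ b, K x y a b ^ 2 * Real.exp (2 * κ * l1 (x - y)) := by
          refine Finset.sum_congr rfl fun y _ => Finset.sum_congr rfl fun b _ => ?_
          show (|K x y a b| * Real.exp (κ * l1 (x - y))) ^ 2 = _
          rw [mul_pow, sq_abs, ← Real.exp_nat_mul]; push_cast; ring_nf
      _ ≤ B ^ 2 := h x a s
  have hg2 : ∑ p ∈ s ×ˢ (univ : Finset F), g p ^ 2 ≤ (Fintype.card F : ℝ) * Zl D (2 * (κ - R)) := by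
    rw [Finset.sum_product]
    exact sum_sq_weight_le' hR x s
  rw [hsum]
  exact sum_mul_le_sqrt_mul _ f g hB hZ hf2 hg2

/-- COMPARISON WITH THE POINTWISE ROUTE (stated, for the record): the pointwise route gives `ColW K R (|F|·B·Zl_D(κ−R))`
(`ColL2.decays` then `HessKerSchur.colW_of_decays`). [folklore] -/
theorem colW_of_colL2_pointwise {K : MKer D F} {κ B R : ℝ} (h : ColL2 K κ B) (hR : R < κ) :
    ColW K R ((Fintype.card F : ℝ) * B * Zl D (κ - R)) :=
  HessKerSchur.colW_of_decays h.decays hR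

/-! ## §3 Rate families: uniform data and geometric deviations keep their shape -/

/-- Uniform weighted-`ℓ²` column data along a family ⟹ uniform `ColW` data. [folklore] -/
theorem colW_of_colL2_uniform {K : ℕ → MKer D F} {κ B R : ℝ} (h : ∀ j, ColL2 (K j) κ B) (hR : R < κ) (j : ℕ) :
    ColW (K j) R (Real.sqrt ((Fintype.card F : ℝ) * Zl D (2 * (κ - R))) * B) :=
  colW_of_colL2 (h j) hR

/-- Geometric weighted-`ℓ²` deviations `ColL2 (K_j − K_∞) κ (c·θ^j)` ⟹ geometric `ColW` deviations with constant `√(|F|·Zl_D(2(κ−R)))·c`,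
same ratio `θ`. [folklore] -/
theorem colW_of_colL2_rate {K : ℕ → MKer D F} {Kinf : MKer D F} {κ c θ R : ℝ}
    (h : ∀ j, ColL2 (K j - Kinf) κ (c * θ ^ j)) (hR : R < κ) (j : ℕ) :
    ColW (K j - Kinf) R (Real.sqrt ((Fintype.card F : ℝ) * Zl D (2 * (κ - R))) * c * θ ^ j) := by
  have h1 := colW_of_colL2 (h j) hR
  rwa [← mul_assoc] at h1

/-- Row twins. [folklore] -/
theorem rowW_of_rowL2_uniform {K : ℕ → MKer D F} {κ B R : ℝ} (h : ∀ j, RowL2 (K j) κ B) (hR : R < κ) (j : ℕ) :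
    RowW (K j) R (Real.sqrt ((Fintype.card F : ℝ) * Zl D (2 * (κ - R))) * B) :=
  rowW_of_rowL2 (h j) hR

/-- Row twin of `colW_of_colL2_rate`. [folklore] -/
theorem rowW_of_rowL2_rate {K : ℕ → MKer D F} {Kinf : MKer D F} {κ c θ R : ℝ}
    (h : ∀ j, RowL2 (K j - Kinf) κ (c * θ ^ j)) (hR : R < κ) (j : ℕ) :
    RowW (K j - Kinf) R (Real.sqrt ((Fintype.card F : ℝ) * Zl D (2 * (κ - R))) * c * θ ^ j) := by
  have h1 := rowW_of_rowL2 (h j) hR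
  rwa [← mul_assoc] at h1

/-! ## §4 END corollary: weighted-`ℓ²` resolvent data in, `GeomRate` at rate `R·N` out -/

section End

variable {d : ℕ}

/-- The lattice constant of the bridge for the fibre `Fib d` of the one-step kernels, abbreviated. [folklore] -/
abbrev zL2 (d : ℕ) (κ R : ℝ) : ℝ := Real.sqrt ((Fintype.card (Fib d) : ℝ) * Zl (d + 1) (2 * (κ - R)))

/-- `zL2` is nonnegative. [folklore] -/
theorem zL2_nonneg (d : ℕ) (κ R : ℝ) : 0 ≤ zL2 d κ R := Real.sqrt_nonneg _

/-- **END-TO-END FROM WEIGHTED-`ℓ²` RESOLVENT DATA** — the literal `OneStepKernelFamily.TstepOf` shape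
`hessKer K (vertexOfK K N S) W`: resolvent columns in `ColL2` at rate `κ` (bound `B_K`, geometric deviations `c_K θ^j`), a Schur
rate `R` with `0 < R < κ`, stencil tables in `LocStencilW` at `R/2`, second-order vertices in `VertexFamily₂W` at `R`, `1 ≤ N` ⟹
`RateCertificate.GeomRate` of the second moments at decay length `R·N` with the `HessKerSchur` constant in which every resolvent
bound is multiplied by `zL2 d κ R = √(|Fib d|·Zl_{d+1}(2(κ−R)))`. [folklore] -/
theorem geomRate_secondMoment_hessKer_primitivesW_of_colL2 {K : ℕ → MKer (d + 1) (Fib d)} {Kinf : MKer (d + 1) (Fib d)}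
    {S : ℕ → Fin (d + 1) → (Fin (d + 1) → ℤ) → MKer (d + 1) (Fib d)}
    {Sinf : Fin (d + 1) → (Fin (d + 1) → ℤ) → MKer (d + 1) (Fib d)}
    {W : ℕ → Fin (d + 1) → (Fin (d + 1) → ℤ) → Fin (d + 1) → (Fin (d + 1) → ℤ) → MKer (d + 1) (Fib d)}
    {Winf : Fin (d + 1) → (Fin (d + 1) → ℤ) → Fin (d + 1) → (Fin (d + 1) → ℤ) → MKer (d + 1) (Fib d)}
    {κ R BK cK Bs cS BW cW θ : ℝ} {N : ℕ}
    (hK : ∀ j, ColL2 (K j) κ BK) (hKinf : ColL2 Kinf κ BK) (hKrate : ∀ j, ColL2 (K j - Kinf) κ (cK * θ ^ j))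
    (hS : ∀ j, LocStencilW (S j) (R / 2) Bs) (hSinf : LocStencilW Sinf (R / 2) Bs)
    (hSrate : ∀ j, LocStencilW (S j - Sinf) (R / 2) (cS * θ ^ j))
    (hW : ∀ j, VertexFamily₂W (W j) N R BW) (hWinf : VertexFamily₂W Winf N R BW)
    (hWrate : ∀ j, VertexFamily₂W (W j - Winf) N R (cW * θ ^ j)) (hR : 0 < R) (hκ : R < κ) (hN : 1 ≤ N)
    (μ ν : Fin (d + 1)) :
    RateCertificate.GeomRate (fun j => B12Beta.secondMoment (hessKer (K j) (vertexOfK (K j) N (S j)) (W j)) μ ν)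
      (B12Beta.secondMoment (hessKer Kinf (vertexOfK Kinf N Sinf) Winf) μ ν)
      (betaPrime510 (d + 1) (lipW (zL2 d κ R * BK) (zL2 d κ R * BK) (zL2 d κ R * BK * Bs) (zL2 d κ R * BK * Bs) BW
        (zL2 d κ R * cK) (zL2 d κ R * cK * Bs + zL2 d κ R * BK * cS) cW) (R * N)) θ :=
  geomRate_secondMoment_hessKer_primitivesW (fun j => colW_of_colL2 (hK j) hκ) (colW_of_colL2 hKinf hκ)
    (fun j => colW_of_colL2_rate hKrate hκ j) hS hSinf hSrate hW hWinf hWrate hR hN μ ν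

/-- … and the road-A2 socket `Drift.OneLoopDrift` from weighted-`ℓ²` resolvent data, defect `c₀/(1−θ)`. [folklore] -/
theorem oneLoopDrift_secondMoment_hessKer_primitivesW_of_colL2 {K : ℕ → MKer (d + 1) (Fib d)} {Kinf : MKer (d + 1) (Fib d)}
    {S : ℕ → Fin (d + 1) → (Fin (d + 1) → ℤ) → MKer (d + 1) (Fib d)}
    {Sinf : Fin (d + 1) → (Fin (d + 1) → ℤ) → MKer (d + 1) (Fib d)}
    {W : ℕ → Fin (d + 1) → (Fin (d + 1) → ℤ) → Fin (d + 1) → (Fin (d + 1) → ℤ) → MKer (d + 1) (Fib d)}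
    {Winf : Fin (d + 1) → (Fin (d + 1) → ℤ) → Fin (d + 1) → (Fin (d + 1) → ℤ) → MKer (d + 1) (Fib d)}
    {κ R BK cK Bs cS BW cW θ : ℝ} {N : ℕ}
    (hK : ∀ j, ColL2 (K j) κ BK) (hKinf : ColL2 Kinf κ BK) (hKrate : ∀ j, ColL2 (K j - Kinf) κ (cK * θ ^ j))
    (hS : ∀ j, LocStencilW (S j) (R / 2) Bs) (hSinf : LocStencilW Sinf (R / 2) Bs)
    (hSrate : ∀ j, LocStencilW (S j - Sinf) (R / 2) (cS * θ ^ j))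
    (hW : ∀ j, VertexFamily₂W (W j) N R BW) (hWinf : VertexFamily₂W Winf N R BW)
    (hWrate : ∀ j, VertexFamily₂W (W j - Winf) N R (cW * θ ^ j)) (hR : 0 < R) (hκ : R < κ) (hN : 1 ≤ N)
    (hθ0 : 0 ≤ θ) (hθ1 : θ < 1) (μ ν : Fin (d + 1)) :
    Drift.OneLoopDrift (B12Beta.secondMoment (hessKer Kinf (vertexOfK Kinf N Sinf) Winf) μ ν)
      (betaPrime510 (d + 1) (lipW (zL2 d κ R * BK) (zL2 d κ R * BK) (zL2 d κ R * BK * Bs) (zL2 d κ R * BK * Bs) BW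
        (zL2 d κ R * cK) (zL2 d κ R * cK * Bs + zL2 d κ R * BK * cS) cW) (R * N) / (1 - θ))
      (fun j => B12Beta.secondMoment (hessKer (K j) (vertexOfK (K j) N (S j)) (W j)) μ ν) :=
  oneLoopDrift_secondMoment_hessKer_primitivesW (fun j => colW_of_colL2 (hK j) hκ) (colW_of_colL2 hKinf hκ)
    (fun j => colW_of_colL2_rate hKrate hκ j) hS hSinf hSrate hW hWinf hWrate hR hN hθ0 hθ1 μ ν

end End

end

end Literature.MathematicalPhysics.QuantumFieldTheory.Balaban1983to89.Beta.HessKerSchurL2
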